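import Summits.ValiantsHypothesis.ValiantsHypothesis.Theorems.TwoProducts.RankThreeWronskianTowerArcs
import Summits.ValiantsHypothesis.ValiantsHypothesis.Theorems.TwoProducts.RankTwoJacobianTower

/-!
# Rank three AFFINE, depth ≤ 1 tools: unique tops multiply, ties of differences, tails, the FIRST DESCENT of a power, the three-summand tie lemma

Toolkit (part 1 of 2) for the located DEPTH ≤ 1 instances of the OPEN rung 3-AFF (val-port-4 g4; crit-8 g4 T1 PRICE LIST 2026-08-29T06:03:38Z,
rulings #57/#58/#60 (U1)/#61/#63 (T1-A′); desk RULING #535 (A)/#542 (E); director R398 (2)).  `--supports stmt-ValiantsHypothesis-5906 --as helper`.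
First user: part 2 ✓ `…RankThreeAffineTrinomialDepthOne` (T1-A′, sums of three powers `Σ gᵢ·wᵢ^{nᵢ}`, in particular the Fermat trinomial
`w₀^a + ρ·w₁^b − κ·w₂^d`).  SIDE-LADDER tools; NOT γ; NOT `ResidualLawV25` / `PlanarCellBound`; 0 summit distance; VP ≠ VNP is NOT proved here or
anywhere in this tree.  (The binomial `w₀^a·w₁^b − κ·w₂^d` needs none of this: it is settled UNCONDITIONALLY by ✓ `…RankThreeAffineBinomial`.)

§1 unique tops multiply (`isUniqueTop_mul`, `isUniqueTop_pow`, with top coefficients; `_one`, `_C_mul`, `_neg`); §2 ties of a difference of two uniquely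
topped polynomials (`tie_sub_cases`: distinct tops of equal weight, or a DENT = equal tops with equal top coefficients); §3 tails and sums
(`tailOf`, `isUniqueTop_monomial`, `isUniqueTop_add_of_below`, `isUniqueTop_add_same`); §4 ★ the FIRST DESCENT `isUniqueTop_pow_sub_pow`:
`(c·X^p + u)^{n+1} − (c·X^p)^{n+1}` is uniquely topped at `n•p + q` (`q` the top of the tail `u`) with coefficient `(n+1)·c^n·u_q`; §5 ★ `tie_three`:
a tie of a sum of three optionally present uniquely topped polynomials forces two PRESENT tops of EQUAL weight; §6 arc data (`exists_utop_pow3`,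
`exists_tail_top3`: tops of carriers and of their tails — the SECOND tops — constant along an arc of ✓ `…RankThreeWronskianTowerArcs`).
No instances, no notation, no named facts. [folklore]
-/

noncomputable section
set_option linter.dupNamespace false

namespace Summit.ValiantsHypothesis.ValiantsHypothesis.Theorems.TwoProducts.RankTwoJacobian

open scoped BigOperators Pointwise Classical
open MvPolynomial

/-! ### §1 Unique tops multiply (with their top coefficients) -/

/-- The constant `1` has the unique top `0`. [folklore] -/
theorem isUniqueTop_one (ν : Fin 2 → ℝ) : IsUniqueTop ν (1 : Poly2) 0 := by
  refine ⟨by simp, fun s hs hs0 => ?_⟩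
  exfalso
  rw [MvPolynomial.mem_support_iff, MvPolynomial.coeff_one] at hs
  exact hs (if_neg fun h => hs0 h.symm)

/-- A nonzero scalar multiple keeps the unique top. [folklore] -/
theorem isUniqueTop_C_mul {ν : Fin 2 → ℝ} {A : Poly2} {p : Expo} {κ : ℂ} (hκ : κ ≠ 0) (hA : IsUniqueTop ν A p) :
    IsUniqueTop ν (C κ * A) p := by
  have hs : ∀ s, s ∈ (C κ * A).support ↔ s ∈ A.support := fun s => by
    rw [MvPolynomial.mem_support_iff, MvPolynomial.mem_support_iff, coeff_C_mul, mul_ne_zero_iff]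
    exact ⟨fun h => h.2, fun h => ⟨hκ, h⟩⟩
  exact ⟨(hs p).mpr hA.1, fun s h hsp => hA.2 s ((hs s).mp h) hsp⟩

/-- Negation keeps the unique top. [folklore] -/
theorem isUniqueTop_neg {ν : Fin 2 → ℝ} {A : Poly2} {p : Expo} (hA : IsUniqueTop ν A p) : IsUniqueTop ν (-A) p := by
  refine ⟨by rw [MvPolynomial.support_neg]; exact hA.1, fun s hs hsp => hA.2 s ?_ hsp⟩
  rwa [MvPolynomial.support_neg] at hs

/-- **Unique tops multiply.** [folklore] -/
theorem isUniqueTop_mul {ν : Fin 2 → ℝ} {A B : Poly2} {p q : Expo} (hA : IsUniqueTop ν A p) (hB : IsUniqueTop ν B q) :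
    IsUniqueTop ν (A * B) (p + q) ∧ coeff (p + q) (A * B) = coeff p A * coeff q B := by
  have huniq : ∀ a ∈ A.support, ∀ b ∈ B.support, a + b = p + q → a = p ∧ b = q := by
    intro a ha b hb hab
    have hwa := hA.le a ha
    have hwb := hB.le b hb
    have hsum : wt ν a + wt ν b = wt ν p + wt ν q := by rw [← wt_add, ← wt_add, hab]
    exact ⟨hA.eq_of_le ha (by linarith), hB.eq_of_le hb (by linarith)⟩
  have hc : coeff (p + q) (A * B) = coeff p A * coeff q B := coeff_mul_of_unique A B p q huniq
  refine ⟨⟨?_, fun s hs hspq => ?_⟩, hc⟩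
  · rw [MvPolynomial.mem_support_iff, hc]
    exact mul_ne_zero (MvPolynomial.mem_support_iff.mp hA.1) (MvPolynomial.mem_support_iff.mp hB.1)
  · obtain ⟨a, ha, b, hb, rfl⟩ := Finset.mem_add.mp (MvPolynomial.support_mul A B hs)
    have hwa := hA.le a ha
    have hwb := hB.le b hb
    rw [wt_add, wt_add]
    rcases lt_or_eq_of_le hwa with hlt | heq
    · linarith
    · have ha' : a = p := hA.eq_of_le ha heq.ge
      rcases lt_or_eq_of_le hwb with hlt' | heq'
      · linarith
      · exact absurd (by rw [ha', hB.eq_of_le hb heq'.ge]) hspq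

/-- **Unique tops of powers:** `A^n` has the unique top `n • p` with top coefficient `(A_p)^n`. [folklore] -/
theorem isUniqueTop_pow {ν : Fin 2 → ℝ} {A : Poly2} {p : Expo} (hA : IsUniqueTop ν A p) :
    ∀ n : ℕ, IsUniqueTop ν (A ^ n) (n • p) ∧ coeff (n • p) (A ^ n) = coeff p A ^ n
  | 0 => by
    refine ⟨by rw [pow_zero, zero_smul]; exact isUniqueTop_one ν, ?_⟩
    rw [pow_zero, zero_smul, pow_zero, MvPolynomial.coeff_one, if_pos rfl]
  | n + 1 => by
    obtain ⟨h1, h2⟩ := isUniqueTop_pow hA n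
    obtain ⟨h3, h4⟩ := isUniqueTop_mul h1 hA
    rw [pow_succ, succ_nsmul]
    exact ⟨h3, by rw [h4, h2, pow_succ]⟩

/-! ### §2 Ties of a difference of two uniquely-topped polynomials -/

/-- If the top of `F` beats the top of `G`, `F − G` keeps `F`'s unique top. [folklore] -/
theorem isUniqueTop_sub_left {ν : Fin 2 → ℝ} {F G : Poly2} {P Q : Expo} (hF : IsUniqueTop ν F P) (hG : IsUniqueTop ν G Q)
    (h : wt ν Q < wt ν P) : IsUniqueTop ν (F - G) P := by
  have hPG : coeff P G = 0 := by
    by_contra hne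
    have := hG.le P (MvPolynomial.mem_support_iff.mpr hne)
    linarith
  refine ⟨?_, fun s hs hsP => ?_⟩
  · rw [MvPolynomial.mem_support_iff, coeff_sub, hPG, sub_zero]
    exact MvPolynomial.mem_support_iff.mp hF.1
  · rcases Finset.mem_union.mp ((MvPolynomial.support_sub ..) hs) with h' | h'
    · exact hF.2 s h' hsP
    · exact lt_of_le_of_lt (hG.le s h') h

/-- Symmetrically, if `G`'s top beats `F`'s, `F − G` has `G`'s unique top. [folklore] -/
theorem isUniqueTop_sub_right {ν : Fin 2 → ℝ} {F G : Poly2} {P Q : Expo} (hF : IsUniqueTop ν F P) (hG : IsUniqueTop ν G Q)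
    (h : wt ν P < wt ν Q) : IsUniqueTop ν (F - G) Q := by
  have h' := isUniqueTop_sub_left hG hF h
  rw [← neg_sub]
  exact isUniqueTop_neg h'

/-- Equal tops with DIFFERENT top coefficients: the top survives in `F − G`. [folklore] -/
theorem isUniqueTop_sub_same {ν : Fin 2 → ℝ} {F G : Poly2} {P : Expo} (hF : IsUniqueTop ν F P) (hG : IsUniqueTop ν G P)
    (hc : coeff P F ≠ coeff P G) : IsUniqueTop ν (F - G) P := by
  refine ⟨?_, fun s hs hsP => ?_⟩
  · rw [MvPolynomial.mem_support_iff, coeff_sub]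
    exact sub_ne_zero.mpr hc
  · rcases Finset.mem_union.mp ((MvPolynomial.support_sub ..) hs) with h' | h'
    · exact hF.2 s h' hsP
    · exact hG.2 s h' hsP

/-- **The tie dichotomy.** A tie of `F − G` (both uniquely topped, at `P` resp. `Q`) forces EITHER distinct tops of equal weight OR a DENT
(equal tops with equal top coefficients). [folklore] -/
theorem tie_sub_cases {ν : Fin 2 → ℝ} {F G : Poly2} {P Q : Expo} (hF : IsUniqueTop ν F P) (hG : IsUniqueTop ν G Q)
    (ht : TieIn ν (F - G).support) : (P ≠ Q ∧ wt ν P = wt ν Q) ∨ (P = Q ∧ coeff P F = coeff Q G) := by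
  by_contra hnot
  push Not at hnot
  rcases lt_trichotomy (wt ν P) (wt ν Q) with hlt | heq | hgt
  · exact not_tie_of_utop ((isUniqueTop_iff _ _ _).mp (isUniqueTop_sub_right hF hG hlt)) ht
  · by_cases hPQ : P = Q
    · subst hPQ
      exact not_tie_of_utop ((isUniqueTop_iff _ _ _).mp (isUniqueTop_sub_same hF hG (hnot.2 rfl))) ht
    · exact (hnot.1 hPQ) heq
  · exact not_tie_of_utop ((isUniqueTop_iff _ _ _).mp (isUniqueTop_sub_left hF hG hgt)) ht

/-! ### §3 Tails, monomial tops, sums with a common or a dominated top -/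

/-- The TAIL of `A` below the point `p`: `A` minus its `X^p` term. -/
def tailOf (A : Poly2) (p : Expo) : Poly2 := A - monomial p (coeff p A)

/-- `A = (its X^p term) + tailOf A p`. [folklore] -/
theorem monomial_add_tailOf (A : Poly2) (p : Expo) : monomial p (coeff p A) + tailOf A p = A := by
  unfold tailOf; abel

/-- Coefficients of the tail. [folklore] -/
theorem coeff_tailOf (A : Poly2) (p s : Expo) : coeff s (tailOf A p) = if s = p then 0 else coeff s A := by
  unfold tailOf
  rw [coeff_sub, coeff_monomial]
  by_cases h : s = p
  · subst h; simp
  · rw [if_neg (fun h' => h h'.symm), if_neg h, sub_zero]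

/-- The tail's support is the support minus `p`. [folklore] -/
theorem support_tailOf (A : Poly2) (p : Expo) : (tailOf A p).support = A.support.erase p := by
  ext s
  rw [MvPolynomial.mem_support_iff, coeff_tailOf, Finset.mem_erase, MvPolynomial.mem_support_iff]
  by_cases h : s = p
  · simp [h]
  · simp [h]

/-- A nonzero monomial has its exponent as unique top. [folklore] -/
theorem isUniqueTop_monomial (ν : Fin 2 → ℝ) (p : Expo) {c : ℂ} (hc : c ≠ 0) : IsUniqueTop ν (monomial p c) p := by
  refine ⟨?_, fun s hs hsp => ?_⟩
  · rw [MvPolynomial.mem_support_iff, coeff_monomial, if_pos rfl]; exact hc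
  · exfalso
    rw [MvPolynomial.mem_support_iff, coeff_monomial] at hs
    exact hs (if_neg fun h => hsp h.symm)

/-- Adding something strictly below the top keeps the unique top. [folklore] -/
theorem isUniqueTop_add_of_below {ν : Fin 2 → ℝ} {F G : Poly2} {P : Expo} (hF : IsUniqueTop ν F P)
    (hG : ∀ s ∈ G.support, wt ν s < wt ν P) : IsUniqueTop ν (F + G) P := by
  have hPG : coeff P G = 0 := by
    by_contra hne
    exact lt_irrefl _ (hG P (MvPolynomial.mem_support_iff.mpr hne))
  refine ⟨?_, fun s hs hsP => ?_⟩
  · rw [MvPolynomial.mem_support_iff, coeff_add, hPG, add_zero]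
    exact MvPolynomial.mem_support_iff.mp hF.1
  · rcases Finset.mem_union.mp (MvPolynomial.support_add hs) with h' | h'
    · exact hF.2 s h' hsP
    · exact hG s h'

/-- Two summands with the SAME unique top and non-cancelling top coefficients. [folklore] -/
theorem isUniqueTop_add_same {ν : Fin 2 → ℝ} {F G : Poly2} {P : Expo} (hF : IsUniqueTop ν F P) (hG : IsUniqueTop ν G P)
    (hc : coeff P F + coeff P G ≠ 0) : IsUniqueTop ν (F + G) P := by
  refine ⟨?_, fun s hs hsP => ?_⟩
  · rw [MvPolynomial.mem_support_iff, coeff_add]; exact hc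
  · rcases Finset.mem_union.mp (MvPolynomial.support_add hs) with h' | h'
    · exact hF.2 s h' hsP
    · exact hG.2 s h' hsP

/-- Everything in a uniquely topped polynomial lies strictly below any weight above its top. [folklore] -/
theorem below_of_utop {ν : Fin 2 → ℝ} {G : Poly2} {Q P : Expo} (hG : IsUniqueTop ν G Q) (h : wt ν Q < wt ν P) :
    ∀ s ∈ G.support, wt ν s < wt ν P := fun s hs => lt_of_le_of_lt (hG.le s hs) h

/-! ### §4 The first descent: the unique top of `(m + u)^{n+1} − m^{n+1}` -/

/-- **First descent of a power.** If `m = c·X^p` (`c ≠ 0`) and the tail `u` is uniquely topped at `q` strictly below `p`, then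
`(m + u)^{n+1} − m^{n+1}` is uniquely topped at `n•p + q` with top coefficient `(n+1)·c^n·u_q` (characteristic `0`). [folklore] -/
theorem isUniqueTop_pow_sub_pow {ν : Fin 2 → ℝ} {u : Poly2} {p q : Expo} {c : ℂ} (hc : c ≠ 0) (hu : IsUniqueTop ν u q)
    (hqp : wt ν q < wt ν p) :
    ∀ n : ℕ, IsUniqueTop ν ((monomial p c + u) ^ (n + 1) - monomial p c ^ (n + 1)) (n • p + q) ∧
      coeff (n • p + q) ((monomial p c + u) ^ (n + 1) - monomial p c ^ (n + 1)) = ((n : ℂ) + 1) * c ^ n * coeff q u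
  | 0 => by
    have h : (monomial p c + u) ^ (0 + 1) - monomial p c ^ (0 + 1) = u := by ring
    rw [h, zero_smul, zero_add, Nat.cast_zero, zero_add, one_mul, pow_zero, one_mul]
    exact ⟨hu, rfl⟩
  | n + 1 => by
    obtain ⟨ih1, ih2⟩ := isUniqueTop_pow_sub_pow hc hu hqp n
    have hsplit : (monomial p c + u) ^ (n + 1 + 1) - monomial p c ^ (n + 1 + 1)
        = (monomial p c + u) * ((monomial p c + u) ^ (n + 1) - monomial p c ^ (n + 1)) + u * monomial p c ^ (n + 1) := by
      ring
    have hmu : IsUniqueTop ν (monomial p c + u) p :=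
      isUniqueTop_add_of_below (isUniqueTop_monomial ν p hc) (below_of_utop hu hqp)
    have hcu0 : coeff p u = 0 := by
      by_contra hne
      exact lt_irrefl _ (lt_of_le_of_lt (hu.le p (MvPolynomial.mem_support_iff.mpr hne)) hqp)
    have hcmu : coeff p (monomial p c + u) = c := by
      rw [coeff_add, coeff_monomial, if_pos rfl, hcu0, add_zero]
    obtain ⟨hA, hcA⟩ := isUniqueTop_mul hmu ih1
    have hmpow : IsUniqueTop ν (monomial p c ^ (n + 1)) ((n + 1) • p) := by
      rw [monomial_pow]; exact isUniqueTop_monomial ν _ (pow_ne_zero _ hc)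
    obtain ⟨hB, hcB⟩ := isUniqueTop_mul hu hmpow
    have he1 : p + (n • p + q) = (n + 1) • p + q := by rw [succ_nsmul]; abel
    have he2 : q + (n + 1) • p = (n + 1) • p + q := add_comm _ _
    rw [he1] at hA hcA
    rw [he2] at hB hcB
    have hcBv : coeff ((n + 1) • p) (monomial p c ^ (n + 1)) = c ^ (n + 1) := by
      rw [monomial_pow, coeff_monomial, if_pos rfl]
    have hsum : coeff ((n + 1) • p + q) ((monomial p c + u) * ((monomial p c + u) ^ (n + 1) - monomial p c ^ (n + 1)))
        + coeff ((n + 1) • p + q) (u * monomial p c ^ (n + 1)) = (((n + 1 : ℕ) : ℂ) + 1) * c ^ (n + 1) * coeff q u := by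
      rw [hcA, hcB, hcmu, ih2, hcBv]
      push_cast
      ring
    have hne : coeff ((n + 1) • p + q) ((monomial p c + u) * ((monomial p c + u) ^ (n + 1) - monomial p c ^ (n + 1)))
        + coeff ((n + 1) • p + q) (u * monomial p c ^ (n + 1)) ≠ 0 := by
      rw [hsum]
      refine mul_ne_zero (mul_ne_zero ?_ (pow_ne_zero _ hc)) (MvPolynomial.mem_support_iff.mp hu.1)
      have : (((n + 1 : ℕ) : ℂ) + 1) = ((n + 2 : ℕ) : ℂ) := by push_cast; ring
      rw [this]; exact Nat.cast_ne_zero.mpr (by omega)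
    rw [hsplit]
    exact ⟨isUniqueTop_add_same hA hB hne, by rw [coeff_add, hsum]⟩

/-! ### §5 A tie of a sum of three optionally present, uniquely topped polynomials -/

/-- **Three-summand tie lemma.** If each `T i` is zero or uniquely topped at `e i`, a tie of `Σ T i` forces two PRESENT summands
whose tops have EQUAL weight. [folklore] -/
theorem tie_three {ν : Fin 2 → ℝ} (T : Fin 3 → Poly2) (e : Fin 3 → Expo) (hT : ∀ i, T i = 0 ∨ IsUniqueTop ν (T i) (e i))
    (ht : TieIn ν (∑ i, T i).support) : ∃ i j : Fin 3, i ≠ j ∧ T i ≠ 0 ∧ T j ≠ 0 ∧ wt ν (e i) = wt ν (e j) := by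
  by_contra hno
  push Not at hno
  set I : Finset (Fin 3) := Finset.univ.filter (fun i => T i ≠ 0) with hI
  have hsumI : ∑ i, T i = ∑ i ∈ I, T i := by
    rw [hI, Finset.sum_filter]
    refine Finset.sum_congr rfl fun i _ => ?_
    by_cases h : T i = 0
    · simp [h]
    · simp [h]
  rcases I.eq_empty_or_nonempty with hIe | hIne
  · -- no summand: the sum vanishes, no tie
    rw [hsumI, hIe, Finset.sum_empty] at ht
    obtain ⟨p, hp, -⟩ := ht
    simp at hp
  · obtain ⟨i₀, hi₀, hmax⟩ := Finset.exists_max_image I (fun i => wt ν (e i)) hIne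
    have hT0 : T i₀ ≠ 0 := (Finset.mem_filter.mp hi₀).2
    have htop0 : IsUniqueTop ν (T i₀) (e i₀) := (hT i₀).resolve_left hT0
    -- the other summands sit strictly below `e i₀`
    have hbelow : ∀ s ∈ (∑ i ∈ I.erase i₀, T i).support, wt ν s < wt ν (e i₀) := by
      intro s hs
      obtain ⟨j, hj, hsj⟩ := Finset.mem_biUnion.mp (MvPolynomial.support_sum hs)
      obtain ⟨hji, hjI⟩ := Finset.mem_erase.mp hj
      have hTj : T j ≠ 0 := (Finset.mem_filter.mp hjI).2
      have htopj : IsUniqueTop ν (T j) (e j) := (hT j).resolve_left hTj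
      have hle := hmax j hjI
      have hne := hno j i₀ hji hTj hT0
      exact below_of_utop htopj (lt_of_le_of_ne hle hne) s hsj
    have hdec : ∑ i, T i = T i₀ + ∑ i ∈ I.erase i₀, T i := by
      rw [hsumI, ← Finset.add_sum_erase I T hi₀]
    have hut : IsUniqueTop ν (∑ i, T i) (e i₀) := by
      rw [hdec]; exact isUniqueTop_add_of_below htop0 hbelow
    exact not_tie_of_utop ((isUniqueTop_iff _ _ _).mp hut) ht

/-! ### §6 Arc data: tops of the carriers and of their tails, constant along an arc -/

/-- Off `X3`, a nonzero power `wᵢ^n` has the unique top `n • p` where — unless `n = 0` — `p` is THE unique top of `wᵢ` along the whole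
arc; the top coefficient is `(wᵢ)_p^n`. [folklore] -/
theorem exists_utop_pow3 {σ : ℝ} (hσ : σ = 1 ∨ σ = -1) {w : Fin 3 → Poly2} {b : ℕ} {μ : ℝ} (hμ : OnArc σ w b μ) (i : Fin 3) (n : ℕ)
    (hn : w i ^ n ≠ 0) :
    ∃ p : Expo, (n = 0 ∨ ∀ μ', OnArc σ w b μ' → IsUniqueTop (dir σ μ') (w i) p) ∧
      ∀ μ', OnArc σ w b μ' → IsUniqueTop (dir σ μ') (w i ^ n) (n • p) ∧ coeff (n • p) (w i ^ n) = coeff p (w i) ^ n := by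
  rcases Nat.eq_zero_or_pos n with rfl | hpos
  · refine ⟨0, Or.inl rfl, fun μ' _ => ?_⟩
    rw [pow_zero, zero_smul, pow_zero, MvPolynomial.coeff_one, if_pos rfl]
    exact ⟨isUniqueTop_one _, rfl⟩
  · have hwi : w i ≠ 0 := fun h => hn (by rw [h, zero_pow hpos.ne'])
    obtain ⟨p, hp⟩ := exists_utop3 hσ hμ.1 hwi (support_subset_S3 w i)
    have harc : ∀ μ', OnArc σ w b μ' → IsUniqueTop (dir σ μ') (w i) p :=
      fun μ' hμ' => utop_onArc hσ hμ hμ' hwi (support_subset_S3 w i) hp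
    exact ⟨p, Or.inr harc, fun μ' hμ' => isUniqueTop_pow (harc μ' hμ') n⟩

/-- The tail of a carrier below its arc-top has (if nonzero) a unique top `q` — the SECOND top — constant along the arc and strictly
below the top. [folklore] -/
theorem exists_tail_top3 {σ : ℝ} (hσ : σ = 1 ∨ σ = -1) {w : Fin 3 → Poly2} {b : ℕ} {μ : ℝ} (hμ : OnArc σ w b μ) (i : Fin 3)
    (p : Expo) (hp : ∀ μ', OnArc σ w b μ' → IsUniqueTop (dir σ μ') (w i) p) :
    ∃ q : Expo, tailOf (w i) p ≠ 0 → ∀ μ', OnArc σ w b μ' →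
      IsUniqueTop (dir σ μ') (tailOf (w i) p) q ∧ wt (dir σ μ') q < wt (dir σ μ') p := by
  by_cases hu : tailOf (w i) p = 0
  · exact ⟨0, fun h => (h hu).elim⟩
  · have hsub : (tailOf (w i) p).support ⊆ S3 w := by
      rw [support_tailOf]; exact (Finset.erase_subset _ _).trans (support_subset_S3 w i)
    obtain ⟨q, hq⟩ := exists_utop3 hσ hμ.1 hu hsub
    refine ⟨q, fun _ μ' hμ' => ?_⟩
    have hq' : IsUniqueTop (dir σ μ') (tailOf (w i) p) q := utop_onArc hσ hμ hμ' hu hsub hq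
    refine ⟨hq', ?_⟩
    have hqs : q ∈ (w i).support.erase p := by rw [← support_tailOf]; exact hq'.1
    obtain ⟨hqp, hqw⟩ := Finset.mem_erase.mp hqs
    exact (hp μ' hμ').2 q hqw hqp

/-- symmetry of the crossing value -/
theorem cross_symm (σ : ℝ) (a b : Expo) : cross σ a b = cross σ b a := by
  unfold cross
  rw [← neg_div_neg_eq]
  congr 1 <;> ring

end Summit.ValiantsHypothesis.ValiantsHypothesis.Theorems.TwoProducts.RankTwoJacobian

end
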